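import Mathlib
import Summits.AtomisticToContinuum.BoseEinsteinCondensation.Theses.BECInsertionCorrector
import Literature.MathematicalPhysics.QuantumManyBody.BoseGasStructureFactor

/-!
# Sketch (crux-ideate gen 2, round 1, ideator 2) for crux `CorrectorClosure`
(stmt-AtomisticToContinuum-12058, route BECInsertionCorrector).

First lemmas of the two idea cards of this seat, STATEMENTS ONLY (typed `Prop`s, no `sorry`):

* card `coarse-field-conditional-residue`: `CondResidueFactorisation` (abstract: the residue of a
  nonnegative `h` is at least the essential infimum of its CONDITIONAL residue given a sub-σ-algebra
  times the residue of the conditional mean) and `OnsagerFromCurvature` (typed over the tree: the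
  static-response curvature hypothesis of `StaticResponseBound` at one lattice momentum bounds the
  structure factor `N·S_N(k)` of a ground state by `N·|p|·√(2C/max(ρa,p²))` — the coarse-density
  variance input of the card).
* card `sourced-semigroup-void-tail`: `SubgaussianResidueFloor` (abstract: a sub-Gaussian LOWER tail of
  `ψ = -log g` gives the residue floor `Z(g) ≥ exp(-2c)`) and `ConvexTangentLowerTail` (abstract: for a
  convex coarse functional the lower tail of `F(Y)` is dominated by that of the tangent linear
  statistic at the mean).
-/

noncomputable section

namespace Summit.AtomisticToContinuum.BoseEinsteinCondensation.Cruxes.CorrectorClosure.Sketch2g2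

open MeasureTheory ProbabilityTheory
open scoped ENNReal NNReal

/-- The residue (participation functional) `Z(h) = (∫ h)² / ∫ h²` of a real function under a
probability law; for `h = Ψ_(N+1)/Θ_N` under `π = |Θ|²dX ⊗ dy/L³` this is the quantity of
`InsertionResidue`. [folklore] -/
def residue {Ω : Type*} [MeasurableSpace Ω] (μ : Measure Ω) (h : Ω → ℝ) : ℝ :=
  (∫ x, h x ∂μ) ^ 2 / ∫ x, h x ^ 2 ∂μ

/-- **Card A, first lemma (conditional residue factorisation).** For a probability law `μ` on
`(Ω, m₀)`, a sub-σ-algebra `m ≤ m₀` (the coarse space-time density field) and `h ≥ 0` square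
integrable: if the CONDITIONAL residue is at least `z₀` a.e., i.e. `z₀ · μ[h² | m] ≤ (μ[h | m])²`,
then `Z(h) ≥ z₀ · Z(μ[h | m])`. Proof: `∫ h = ∫ μ[h|m]` and
`∫ h² = ∫ μ[h²|m] ≤ z₀⁻¹ ∫ (μ[h|m])²`. [folklore] -/
def CondResidueFactorisation : Prop :=
  ∀ (Ω : Type) (m m₀ : MeasurableSpace Ω) (μ : Measure[m₀] Ω), IsProbabilityMeasure μ → m ≤ m₀ →
    ∀ (h : Ω → ℝ) (z₀ : ℝ), 0 < z₀ → Integrable[m₀] h μ → Integrable[m₀] (fun x => h x ^ 2) μ →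
      (0 ≤ᵐ[μ] h) → (0 < ∫ x, h x ^ 2 ∂μ) →
      (∀ᵐ x ∂μ, z₀ * (μ[(fun y => h y ^ 2)|m]) x ≤ ((μ[h|m]) x) ^ 2) →
        z₀ * residue μ (μ[h|m]) ≤ residue μ h

/-- **Card B, first lemma (sub-Gaussian lower tail ⇒ residue floor).** If the centred
log-amplitude `ψ̄ - ψ` (`ψ = -log g`, `ψ̄ = ∫ ψ`) has a sub-Gaussian moment generating function
with variance proxy `c`, then `Z(g) = Z(e^{-ψ}) ≥ exp(-2c)`: Jensen gives `(∫ e^{-ψ})² ≥ e^{-2ψ̄}`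
and the mgf bound at `t = 2` gives `∫ e^{-2ψ} ≤ e^{-2ψ̄} e^{2c}`. Only the LOWER tail of `ψ`
(= the UPPER tail of `g`: the tagged boson in a density deficit of the bath) is used.
[folklore] -/
def SubgaussianResidueFloor : Prop :=
  ∀ (Ω : Type) (_ : MeasurableSpace Ω) (μ : Measure Ω), IsProbabilityMeasure μ →
    ∀ (ψ : Ω → ℝ) (c : ℝ≥0), Integrable ψ μ →
      HasSubgaussianMGF (fun x => (∫ y, ψ y ∂μ) - ψ x) c μ →
        Real.exp (-2 * (c : ℝ)) ≤ residue μ (fun x => Real.exp (-ψ x))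

/-- **Card B, second lemma (convex tangent reduction of the lower tail).** For a convex coarse
functional `F : ℝⁿ → ℝ` differentiable at the mean `Ȳ = ∫ Y` of a random vector `Y`, and every
`t ≥ 0`: `∫ exp(t (F(Ȳ) - F(Y))) ≤ ∫ exp(t ⟪∇F(Ȳ), Ȳ - Y⟫)` (tangent plane below the graph); so a
sub-Gaussian LINEAR statistic of the coarse field controls the lower tail of `F(Y)`. [folklore] -/
def ConvexTangentLowerTail : Prop :=
  ∀ (Ω : Type) (_ : MeasurableSpace Ω) (μ : Measure Ω), IsProbabilityMeasure μ →
    ∀ (n : ℕ) (Y : Ω → EuclideanSpace ℝ (Fin n)) (F : EuclideanSpace ℝ (Fin n) → ℝ)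
      (F' : EuclideanSpace ℝ (Fin n)), Integrable Y μ → ConvexOn ℝ Set.univ F →
      HasGradientAt F F' (∫ y, Y y ∂μ) → ∀ t : ℝ, 0 ≤ t →
        Integrable (fun x => Real.exp (t * inner ℝ F' ((∫ y, Y y ∂μ) - Y x))) μ →
        ∫ x, Real.exp (t * (F (∫ y, Y y ∂μ) - F (Y x))) ∂μ ≤
          ∫ x, Real.exp (t * inner ℝ F' ((∫ y, Y y ∂μ) - Y x)) ∂μ

open Literature.MathematicalPhysics.QuantumManyBody.BoseGas in
/-- **Card A/B, typed bridge (Onsager–Feynman bound from the curvature reading of K1).** On a torus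
of side `L > 0`, if a periodic trial state `Θ` ATTAINS the periodic ground-state energy (finite) and
the energy-currency response bound of `StaticResponseBound` holds at the lattice momentum `k ≠ 0`
with constant `C/D` (`D = max(ρa, |p|²)` abstracted as a positive real), then the structure
factor obeys `N S_N(k) ≤ N |p| √(2C/D)`, i.e. `S(k) ≤ √(m₁ m₋₁)` with the f-sum value
`m₁ = N|p|²/2`... written squared and junk-free: `structureFactorVar² ≤ 2 C N² |p|² / D`.
Long-wavelength consequence used by the cards: coarse density (number) fluctuations are
sub-Poissonian, `S(k) ≤ C' |k| ξ`. [cite: PitaevskiiStringari1991; Stringari1995 §2.2 (11)] -/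
def OnsagerFromCurvature : Prop :=
  ∀ (v : ℝ → ℝ≥0∞) (N : ℕ) (L C D : ℝ), 0 < L → 0 ≤ C → 0 < D →
    ∀ (k : Fin 3 → ℤ) (Θ : PeriodicTrialState N L), k ≠ 0 →
      periodicEnergy v Θ = periodicGroundStateEnergy v N L → periodicEnergy v Θ ≠ ⊤ →
      (∀ (t : ℝ) (Ψ : PeriodicTrialState N L), periodicEnergy v Ψ ≠ ⊤ →
        (periodicGroundStateEnergy v N L).toReal - C / D * t ^ 2 * N ≤
          (periodicEnergy v Ψ).toReal +
            t * ∫ X in cellN N L, (∑ j, Real.cos (2 * Real.pi / L * ∑ i, (k i : ℝ) * X j i)) *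
              ‖Ψ.ψ X‖ ^ 2) →
      (structureFactorVar N L Θ.ψ k) ^ 2 ≤
        ENNReal.ofReal (2 * C * (N : ℝ) ^ 2 * ((2 * Real.pi / L) ^ 2 * ∑ i, (k i : ℝ) ^ 2) / D)

/-- The implication shape of card A's line towards the crux: a coarse-field conditional residue
floor (GP-box input) and an infrared residue floor for the conditional mean (thermodynamic /
sub-Gaussian input) give the crux. The two hypotheses are left abstract here (`Prop` parameters);
crux-plan types them over a coarse-graining σ-algebra on `Config (N+1)`. [folklore] -/
def CoarseFieldLine (LocalResidueFloor InfraredResidueFloor : Prop) : Prop :=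
  LocalResidueFloor → InfraredResidueFloor →
    Summit.AtomisticToContinuum.BoseEinsteinCondensation.Theses.BECInsertionCorrector.CorrectorClosure

end Summit.AtomisticToContinuum.BoseEinsteinCondensation.Cruxes.CorrectorClosure.Sketch2g2

end
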